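import Summits.BirchSwinnertonDyer.BirchSwinnertonDyer.Theorems.EdixhovenFibreFiveSevenLTwistTransferAssembly
import Summits.BirchSwinnertonDyer.BirchSwinnertonDyer.Theorems.AdditiveKolyvaginRoadManinFrameResidueProperRAuxPrime
import HarnessLib
/-!
# TDS57 and KP57 from F″ ALONE — the transfer road with its witness discharged
# (route `EdixhovenFibreFiveSeven`, cruxes 22227 / 23810, `--supports`)

Cell `pub/bsd-wall`, seat `bsd-wall-manin-p1` (prover; AKR crux #7, line `tame_twist` — landing the two sibling-route one-liners
announced on the bus 2026-08-28T02:3xZ, dedup-cleared with `bsd-line-edix-p3`). THEOREMS ONLY (no definition, no named fact, no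
`sorry`). CONDITIONAL RESULTS on the cite-only fact F″; nothing is closed unconditionally; BSD is not proved by this file.

edix-p3's transfer assembly (`LTwistTransfer.twistDegreeStepFiveSeven_of_kato_of_transferWitness`,
`…kpResidueManinUnitFiveSeven_of_kato_of_transferWitness`, p594464; Ihara-free L-TWIST `lTwist_of_transfer`, p594163) fed with the
PROVED transfer witness `AuxPrime.transferWitness` (p595883: the auxiliary prime `q ∤ 2pN`, `q*` a non-square mod `p`,
`p ∤ (q−1)((q+1)² − a_q²)`, by Chebotarev and the `GL₂(𝔽_p)` group theory `AuxPrime.exists_nonsquare_det_trace_ne`). Hence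
TDS57 ⟸ F″ and KP57 ⟸ modularity ∧ F″, with NO Ihara lemma, NO cite-only Chebotarev and NO non-Eisenstein witness in the cone.

References: [Kato2004Asterisque] (8.1.3), Thm. 9.7, Thm. 6.6; [KimNakamura2020] Cor. 2.4; [KostersPannekoek2017] Thm. 1;
[TateGCFT1967] §2.4.
-/

set_option autoImplicit false
-- the Theorems directory repeats the summit name (sibling precedent `SignedBaseChangeAssembly.lean`)
set_option linter.dupNamespace false

noncomputable section

open Literature.NumberTheory.EllipticCurves Literature.NumberTheory.EllipticCurves.ModularForms
  Summit.BirchSwinnertonDyer.BirchSwinnertonDyer.Theses.EdixhovenFibreFiveSeven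

namespace Summit.BirchSwinnertonDyer.BirchSwinnertonDyer.Theorems.LTwistTransfer

/-- **TDS57 `TwistDegreeStepFiveSeven` (stmt-BirchSwinnertonDyer-22227) ⟸ F″ alone** — the transfer assembly with its
Chebotarev witness `AuxPrime.transferWitness` discharged. CONDITIONAL RESULT on
`kato_neron_isIntegral_twistedSymbolSum_of_additive_five_le`; the item stays open; BSD is not proved by this.
[cite: Kato2004Asterisque, (8.1.3) (p. 180), Thm. 9.7 (p. 189)] [cite: KimNakamura2020, Cor. 2.4] -/
theorem twistDegreeStepFiveSeven_of_kato
    (hF : kato_neron_isIntegral_twistedSymbolSum_of_additive_five_le) : TwistDegreeStepFiveSeven :=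
  twistDegreeStepFiveSeven_of_kato_of_transferWitness hF AuxPrime.transferWitness

/-- **KP57 `KPResidueManinUnitFiveSeven` (stmt-BirchSwinnertonDyer-23810) ⟸ modularity ∧ F″** — the transfer assembly with
its Chebotarev witness `AuxPrime.transferWitness` discharged. CONDITIONAL RESULT; the item stays open; BSD is not proved by
this. [cite: KostersPannekoek2017, Thm. 1 and Cor. 2] [cite: Kato2004Asterisque, (8.1.3) (p. 180), Thm. 9.7 (p. 189)] -/
theorem kpResidueManinUnitFiveSeven_of_kato (hnf : exists_isNewformOf)
    (hF : kato_neron_isIntegral_twistedSymbolSum_of_additive_five_le) : KPResidueManinUnitFiveSeven :=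
  kpResidueManinUnitFiveSeven_of_kato_of_transferWitness hnf hF AuxPrime.transferWitness

end Summit.BirchSwinnertonDyer.BirchSwinnertonDyer.Theorems.LTwistTransfer

end
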